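import Summits.ResolutionOfSingularities.ResolutionOfSingularities.Theorems.PurelyInseparableDim4SpineDrop
import Summits.ResolutionOfSingularities.ResolutionOfSingularities.Theorems.PurelyInseparableDim4SpineDictionary
import Summits.ResolutionOfSingularities.ResolutionOfSingularities.Theorems.PurelyInseparableDim4SpineCertCycles
import HarnessLib
import HarnessLib.Audit.Tags

/-!
# Purely inseparable fourfolds — NO FIXED POINT on the spine: every literal cycle of an inclusion-minimal rule has period ≥ 2

Census cell «res-dim4-pi» (D-0157 DOOR 2), seat res-dim4-p-8 (W3-3 follow-up; Q-CF∀ consortium).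
[OURS · counted 0 · AI kernel work, weaker than expert review.]  Nothing here is about resolution of
singularities itself; nothing here proves resolution in dimension ≥ 4 / characteristic `p`.  DEF-FREE.

The literal cycle census of record (engine B, `kb/S1a-1h-L6-cycles-literal.tsv` 3b8549b6dd3da189) has
period-1 rows — one-state MODE-1h loops — but EVERY one of them uses a translated move (`t ≠ 0`, the
TRAP-1 shape); its 1 265 SPINE rows all have period ≥ 2 (`SpineCertBatch*`: periods 2, 3, 4, 5, …).
This file proves why: a pure move `(J, j)` with `J` INCLUSION-MINIMAL among the permissible centres
(in particular CARDINALITY-FIRST = the support shadow of MODE 1h, any tie-breaking) never maps a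
not-yet-won position onto itself (`0 < q`).  Argument: the move changes only the `j`-th coordinate, by
the amount `Σ_{i∈J∖j} aᵢ − q`, which is constant on the monomials sharing their other coordinates; if
the image were the position itself, the monomial with least `j`-th coordinate among those sharing the
off-`j` coordinates of the DROPPING WITNESS (`SpineDrop.exists_degree_lt_of_minimal`) would be the image of
nobody.

* §1 `pureMove_ne_self_of_minimal` / `_of_cardFirst`, `spineMove_ne_self_of_minimal` / `_of_cardFirst`
  (the game with deletions), `isPurePlay_succ_ne` / `isSpinePlay_succ_ne` (consecutive positions of a
  cardinality-first play differ);
* §2 state level, through `res-dim4-p-7`'s dictionary `SpineDictionary.support_step_origin`: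
  `not_spineEdge_self_of_minimal` and **`not_spineEdge_self_of_isMode1hCentre`** — a MODE-1h centre has no
  spine self-loop: a one-state literal MODE-1h cycle must use a translated point.

[cite: Spivakovsky1983, §1 (Hironaka's polyhedra game: the move)]
bears_on: LADDER-RESOLUTION:D157-DOOR2 (res-dim4-pi · W3-3 · Q-CF∀). Supports stmt-ResolutionOfSingularities-16155 (helper).
-/

-- cell convention (DR-157-C): the summit's doubled path segment is intended, as in the landed Target file
set_option linter.dupNamespace false

namespace Summit.ResolutionOfSingularities.ResolutionOfSingularities.Theorems.PIDim4.SpineNoFixedPoint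

open Finset
open Literature.AlgebraicGeometry.Resolution
open Literature.AlgebraicGeometry.Resolution.CentreBlowup

/-! ## 1. Support level -/

/-- The `(J ∖ j)`-degree only reads coordinates other than `j`. [folklore] -/
theorem degIn_erase_congr {J : Finset (Fin 4)} {j : Fin 4} {a b : Fin 4 →₀ ℕ}
    (h : ∀ i, i ≠ j → b i = a i) : degIn (J.erase j) b = degIn (J.erase j) a :=
  Finset.sum_congr rfl fun i hi => h i (Finset.ne_of_mem_erase hi)

/-- The chart image agrees with its source off the chart coordinate. [folklore] -/
theorem chartExponent_apply_ne' {q : ℕ} {J : Finset (Fin 4)} {j i : Fin 4} (hij : i ≠ j)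
    (a : Fin 4 →₀ ℕ) : chartExponent q J j a i = a i :=
  chartExponent_apply_of_ne q J hij a

/-- **No fixed point (inclusion-minimal centre).**  If `J` is permissible at the not-yet-won position `A`,
no proper subset of `J` is permissible, `j ∈ J` and `0 < q`, then the pure move does not fix `A`. [folklore] -/
theorem pureMove_ne_self_of_minimal {q : ℕ} (hq : 0 < q) {J : Finset (Fin 4)} {j : Fin 4} {A : SpinePos}
    (hA : ¬ SpineWon q A) (hperm : SpinePermissible q J A)
    (hmin : ∀ J' : Finset (Fin 4), J' ⊂ J → ¬ SpinePermissible q J' A) (hj : j ∈ J) :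
    pureMove q J j A ≠ A := by
  intro hfix
  -- the dropping witness: a monomial with small `(J ∖ j)`-degree
  obtain ⟨a, ha, hdrop⟩ := SpineDrop.exists_degree_lt_of_minimal hq hA hperm hmin hj
  have hsmall : degIn (J.erase j) a < q :=
    (SpineDrop.degree_chartExponent_lt_iff hj (hperm.2 a ha)).mp hdrop
  -- the monomials of `A` sharing the off-`j` coordinates of `a`, and the least `j`-th coordinate among them
  set A₀ : Finset (Fin 4 →₀ ℕ) := A.filter fun b => ∀ i, i ≠ j → b i = a i with hA₀
  have haA₀ : a ∈ A₀ := Finset.mem_filter.mpr ⟨ha, fun _ _ => rfl⟩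
  obtain ⟨b, hb, hbmin⟩ := Finset.exists_min_image A₀ (fun c => c j) ⟨a, haA₀⟩
  obtain ⟨hbA, hboff⟩ := Finset.mem_filter.mp hb
  -- its image lies in `A` (fixed point) and again in `A₀`
  have himgA : chartExponent q J j b ∈ A := by
    rw [← hfix]
    exact Finset.mem_image_of_mem _ hbA
  have himgA₀ : chartExponent q J j b ∈ A₀ := by
    refine Finset.mem_filter.mpr ⟨himgA, fun i hi => ?_⟩
    rw [chartExponent_apply_ne' hi, hboff i hi]
  -- but its `j`-th coordinate is smaller than the minimum
  have hlt : chartExponent q J j b j < b j := by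
    have h1 := chartExponent_apply_self q J j b
    have h2 := Perm2Bound.degIn_eq_add_degIn_erase hj b
    have h3 : degIn (J.erase j) b = degIn (J.erase j) a := degIn_erase_congr hboff
    have h4 := hperm.2 b hbA
    omega
  exact Nat.lt_irrefl _ (lt_of_le_of_lt (hbmin _ himgA₀) hlt)

/-- **No fixed point (cardinality-first centre, any tie-breaking).** [folklore] -/
theorem pureMove_ne_self_of_cardFirst {q : ℕ} (hq : 0 < q) {J : Finset (Fin 4)} {j : Fin 4}
    {A : SpinePos} (hA : ¬ SpineWon q A) (hperm : SpinePermissible q J A)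
    (hcard : ∀ J' : Finset (Fin 4), SpinePermissible q J' A → J.card ≤ J'.card) (hj : j ∈ J) :
    pureMove q J j A ≠ A :=
  pureMove_ne_self_of_minimal hq hA hperm
    (fun _ hJ' => SpineOrthant.not_spinePermissible_of_ssubset_of_cardFirst hcard hJ') hj

/-- The game WITH deletions: an inclusion-minimal centre has no fixed point either (a fixed point of the
spine move would be one of the pure move, by counting). [folklore] -/
theorem spineMove_ne_self_of_minimal {q : ℕ} (hq : 0 < q) {J : Finset (Fin 4)} {j : Fin 4}
    {A : SpinePos} (hA : ¬ SpineWon q A) (hperm : SpinePermissible q J A)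
    (hmin : ∀ J' : Finset (Fin 4), J' ⊂ J → ¬ SpinePermissible q J' A) (hj : j ∈ J) :
    spineMove q J j A ≠ A := by
  intro hfix
  apply pureMove_ne_self_of_minimal hq hA hperm hmin hj
  have hsub : A ⊆ pureMove q J j A := by
    intro x hx
    rw [← hfix] at hx
    exact spineMove_subset_pureMove q J j A hx
  exact (Finset.eq_of_subset_of_card_le hsub Finset.card_image_le).symm

/-- The game with deletions, cardinality-first form. [folklore] -/
theorem spineMove_ne_self_of_cardFirst {q : ℕ} (hq : 0 < q) {J : Finset (Fin 4)} {j : Fin 4}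
    {A : SpinePos} (hA : ¬ SpineWon q A) (hperm : SpinePermissible q J A)
    (hcard : ∀ J' : Finset (Fin 4), SpinePermissible q J' A → J.card ≤ J'.card) (hj : j ∈ J) :
    spineMove q J j A ≠ A :=
  spineMove_ne_self_of_minimal hq hA hperm
    (fun _ hJ' => SpineOrthant.not_spinePermissible_of_ssubset_of_cardFirst hcard hJ') hj

/-- **Consecutive positions of a cardinality-first pure play differ** (every literal cycle of the rule has
period ≥ 2). [folklore] -/
theorem isPurePlay_succ_ne {q : ℕ} (hq : 0 < q) {σ : SpineStrategy}
    (hσ : ∀ A : SpinePos, ¬ SpineWon q A →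
      SpinePermissible q (σ A) A ∧ ∀ J' : Finset (Fin 4), SpinePermissible q J' A → (σ A).card ≤ J'.card)
    {P : ℕ → SpinePos} (hP : IsPurePlay q σ P) (n : ℕ) : P (n + 1) ≠ P n := by
  obtain ⟨hnotwon, j, hj, hsucc⟩ := hP n
  obtain ⟨hperm, hcard⟩ := hσ (P n) hnotwon
  rw [hsucc]
  exact pureMove_ne_self_of_cardFirst hq hnotwon hperm hcard hj

/-- The same for plays of the game with deletions. [folklore] -/
theorem isSpinePlay_succ_ne {q : ℕ} (hq : 0 < q) {σ : SpineStrategy}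
    (hσ : ∀ A : SpinePos, ¬ SpineWon q A →
      SpinePermissible q (σ A) A ∧ ∀ J' : Finset (Fin 4), SpinePermissible q J' A → (σ A).card ≤ J'.card)
    {P : ℕ → SpinePos} (hP : IsSpinePlay q σ P) (n : ℕ) : P (n + 1) ≠ P n := by
  obtain ⟨hnotwon, j, hj, hsucc⟩ := hP n
  obtain ⟨hperm, hcard⟩ := hσ (P n) hnotwon
  rw [hsucc]
  exact spineMove_ne_self_of_cardFirst hq hnotwon hperm hcard hj

/-! ## 2. State level: no MODE-1h spine self-loop -/

/-- **No spine self-loop under an inclusion-minimal permissible centre.**  For a presented state `s` over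
any field, a Hironaka-permissible coordinate centre `S` none of whose proper sub-centres is permissible, and
`0 < q`: no SPINE edge (chart origin) along `S` leads from `s` back to `s` literally. [folklore] -/
theorem not_spineEdge_self_of_minimal {K : Type} [Field K] [DecidableEq K] {q : ℕ} (hq : 0 < q)
    {S : Finset (Fin 4)} {s : State K} (hS : IsPermissibleCentre q S s.F)
    (hmin : ∀ S' : Finset (Fin 4), S' ⊂ S → ¬ IsPermissibleCentre q S' s.F) :
    ¬ SpineEdge q S s s := by
  rintro ⟨j, hj, -, hne, hs⟩
  -- supports: the step at the origin is the spine move on the support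
  have hsupp := SpineDictionary.support_step_origin hj s hS
  rw [← hs] at hsupp
  -- not yet won, on the support
  have hF : s.F ≠ 0 := by rw [hs]; exact hne
  have hnotwon : ¬ SpineWon q s.F.support := by
    rw [SpineDictionary.not_spineWon_support_iff]
    exact ⟨hF, hS.2.trans (ordAlong_mono (Finset.subset_univ S) s.F)⟩
  -- permissibility and minimality on the support
  have hperm : SpinePermissible q S s.F.support := (spinePermissible_support_iff q S s.F).mpr hS
  have hmin' : ∀ S' : Finset (Fin 4), S' ⊂ S → ¬ SpinePermissible q S' s.F.support :=
    fun S' hS' h => hmin S' hS' ((spinePermissible_support_iff q S' s.F).mp h)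
  exact spineMove_ne_self_of_minimal hq hnotwon hperm hmin' hj hsupp.symm

/-- **No MODE-1h spine self-loop.**  A MODE-1h centre of record (Hironaka-permissible of least
cardinality, any tie) admits no spine edge from a state back to itself (`0 < q`): every one-state literal
MODE-1h cycle of the census uses a translated point. [folklore] -/
theorem not_spineEdge_self_of_isMode1hCentre {K : Type} [Field K] [DecidableEq K] {q : ℕ} (hq : 0 < q)
    {S : Finset (Fin 4)} {s : State K} (hS : IsMode1hCentre q S s.F) : ¬ SpineEdge q S s s :=
  not_spineEdge_self_of_minimal hq hS.1 fun S' hS' h =>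
    Nat.lt_irrefl _ ((Finset.card_lt_card hS').trans_le (hS.2 S' h))

end Summit.ResolutionOfSingularities.ResolutionOfSingularities.Theorems.PIDim4.SpineNoFixedPoint
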